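import Summits.ValiantsHypothesis.ValiantsHypothesis.Theorems.LacunarySymmetroidMatrixDescartesCensusIntervalParity
import Summits.ValiantsHypothesis.ValiantsHypothesis.Theorems.LacunarySymmetroidMatrixDescartesCensusDoorA34NodeTypeLaw

/-!
# `MatrixDescartes` census — node walls at ARBITRARY position and the general parity rule between two simple walls

HONEST FRAMING.  Object-search cell `pub-symmetroid`, door-A seat `val-sym-door-p3` (g9); item stmt-ValiantsHypothesis-19980
`DoorA34 = PosRootLawAt 3 4 18` (route item `Theses.LacunarySymmetroid.DoorA34`) is OPEN and asserted nowhere in this file.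
Companion of `…CensusIntervalParity` (interval parity; the wall pair `ℓ₃ = 0`, `ℓ₃ = 0`) and `…CensusDoorA34NodeTypeLaw`
(reindexing of the node sum by a permutation):

* `det_eq_of_node_zero` — the WALL FORMULA at any node index `j`: if `ℓⱼ = 0` then
  `det (∑ᵢ ℓᵢ • vᵢvᵢᵀ) = det(v_{σ0}; v_{σ1}; v_{σ2})² · ℓ_{σ0} ℓ_{σ1} ℓ_{σ2}` with `σ = swap j 3` (the other three nodes);
  `det_ne_zero_of_simpleWall'` — no det-root on a simple wall of ANY node nomial (general position).
* **`det_walls_parity`** — GENERAL PARITY RULE: for a node-frame pencil in general position and two simple walls `t₁ < t₂` of node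
  nomials `ℓ_{j₁}`, `ℓ_{j₂}` (any indices), the number of det-roots in `(t₁,t₂)` counted with multiplicity is EVEN iff the products of
  the three non-vanishing node values at `t₁` and at `t₂` have the same sign.  Reading (inertia language, `…NodeChambers`): a
  chamber visit carries an ODD number of roots iff it is monotone (`k−1 → k → k+1` or back down), an EVEN number iff it returns.

Nothing here bounds `ζ_sym(3,4)`; `DoorA34` stays OPEN; nothing bears on `MatrixDescartes` (stmt-ValiantsHypothesis-18050) or on
`VP ≠ VNP`.  [folklore] Bookkeeping over the two cited files.
-/

-- `Summit.ValiantsHypothesis.ValiantsHypothesis.…` repeats a component by the D-0017 layout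
-- (single-conjunct summit), which the `dupNamespace` linter flags; the name is mandated.
set_option linter.dupNamespace false

namespace Summit.ValiantsHypothesis.ValiantsHypothesis.Theorems.LacunarySymmetroidMatrixDescartes.Census

open Finset Polynomial
open scoped BigOperators Matrix Polynomial
open Summit.ValiantsHypothesis.ValiantsHypothesis.Theorems.SymmetroidDescartes (eval_det_pencil)

/-- **Wall formula at any node index.**  If `ℓⱼ = 0` then, with `σ = swap j 3`,
`det (∑ᵢ ℓᵢ • vᵢvᵢᵀ) = det(v_{σ0}; v_{σ1}; v_{σ2})² · ℓ_{σ0} ℓ_{σ1} ℓ_{σ2}`. [folklore] -/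
theorem det_eq_of_node_zero (v : Fin 4 → Fin 3 → ℝ) (ℓ : Fin 4 → ℝ) (j : Fin 4) (hj : ℓ j = 0) :
    (∑ i, ℓ i • Matrix.vecMulVec (v i) (v i)).det =
      (Matrix.of ![v (Equiv.swap j 3 0), v (Equiv.swap j 3 1), v (Equiv.swap j 3 2)]).det ^ 2 *
        (ℓ (Equiv.swap j 3 0) * ℓ (Equiv.swap j 3 1) * ℓ (Equiv.swap j 3 2)) := by
  rw [← sum_four_rankOne_reindex v ℓ (Equiv.swap j 3)]
  exact det_eq_of_node_three_zero (fun i => v (Equiv.swap j 3 i)) (fun i => ℓ (Equiv.swap j 3 i))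
    (by simp only [Equiv.swap_apply_right]; exact hj)

/-- **No det-root on a simple wall of ANY node nomial** (frame in general position: every ordered triple of distinct nodes
independent). [folklore] -/
theorem det_ne_zero_of_simpleWall' (v : Fin 4 → Fin 3 → ℝ) (ℓ : Fin 4 → ℝ)
    (hgp : ∀ a b c : Fin 4, a ≠ b → b ≠ c → a ≠ c → (Matrix.of ![v a, v b, v c]).det ≠ 0)
    (j : Fin 4) (hj : ℓ j = 0) (hne : ∀ i, i ≠ j → ℓ i ≠ 0) :
    (∑ i, ℓ i • Matrix.vecMulVec (v i) (v i)).det ≠ 0 := by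
  rw [det_eq_of_node_zero v ℓ j hj]
  have hσ : ∀ i : Fin 4, i ≠ 3 → Equiv.swap j 3 i ≠ j := by
    intro i hi h
    have : Equiv.swap j 3 (Equiv.swap j 3 i) = Equiv.swap j 3 j := by rw [h]
    rw [Equiv.swap_apply_self, Equiv.swap_apply_left] at this
    exact hi this
  refine mul_ne_zero (pow_ne_zero 2 (hgp _ _ _ ?_ ?_ ?_))
    (mul_ne_zero (mul_ne_zero (hne _ (hσ 0 (by decide))) (hne _ (hσ 1 (by decide)))) (hne _ (hσ 2 (by decide))))
  all_goals intro h
  all_goals have := (Equiv.swap j 3).injective h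
  all_goals simp at this

/-- **GENERAL PARITY RULE between two simple walls.**  Let `S l = ∑ᵢ A i l • vᵢvᵢᵀ` with a frame in general position, and let
`t₁ < t₂` be simple walls: `ℓ_{j₁}(t₁) = 0`, `ℓ_{j₂}(t₂) = 0`, the other three node nomials non-zero at each.  Then `det F ≠ 0` at the
walls and the number of det-roots in `(t₁,t₂)` counted with multiplicity is EVEN iff
`(∏_{i ≠ j₁} ℓᵢ(t₁)) · (∏_{i ≠ j₂} ℓᵢ(t₂)) > 0` (products written through `swap jₖ 3`). [folklore] -/
theorem det_walls_parity {K : ℕ} (d : Fin K → ℕ) (A : Fin 4 → Fin K → ℝ) (v : Fin 4 → Fin 3 → ℝ)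
    (hgp : ∀ a b c : Fin 4, a ≠ b → b ≠ c → a ≠ c → (Matrix.of ![v a, v b, v c]).det ≠ 0)
    {t₁ t₂ : ℝ} (ht : t₁ < t₂) (j₁ j₂ : Fin 4)
    (h₁ : ∑ l, A j₁ l * t₁ ^ d l = 0) (hne₁ : ∀ i, i ≠ j₁ → ∑ l, A i l * t₁ ^ d l ≠ 0)
    (h₂ : ∑ l, A j₂ l * t₂ ^ d l = 0) (hne₂ : ∀ i, i ≠ j₂ → ∑ l, A i l * t₂ ^ d l ≠ 0)
    (hP : (∑ l, (X : ℝ[X]) ^ d l • (∑ i, A i l • Matrix.vecMulVec (v i) (v i)).map C).det ≠ 0) :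
    Even ((∑ l, (X : ℝ[X]) ^ d l • (∑ i, A i l • Matrix.vecMulVec (v i) (v i)).map C).det.roots.countP
        (fun r => t₁ < r ∧ r < t₂)) ↔
      0 < ((∑ l, A (Equiv.swap j₁ 3 0) l * t₁ ^ d l) * (∑ l, A (Equiv.swap j₁ 3 1) l * t₁ ^ d l)
            * (∑ l, A (Equiv.swap j₁ 3 2) l * t₁ ^ d l)) *
          ((∑ l, A (Equiv.swap j₂ 3 0) l * t₂ ^ d l) * (∑ l, A (Equiv.swap j₂ 3 1) l * t₂ ^ d l)
            * (∑ l, A (Equiv.swap j₂ 3 2) l * t₂ ^ d l)) := by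
  have hev : ∀ t : ℝ, ((∑ l, (X : ℝ[X]) ^ d l • (∑ i, A i l • Matrix.vecMulVec (v i) (v i)).map C).det).eval t
      = (∑ i, (∑ l, A i l * t ^ d l) • Matrix.vecMulVec (v i) (v i)).det := fun t =>
    eval_det_pencil_rankOneLetters d A v t
  -- the two wall values
  set D₁ := (Matrix.of ![v (Equiv.swap j₁ 3 0), v (Equiv.swap j₁ 3 1), v (Equiv.swap j₁ 3 2)]).det with hD₁
  set D₂ := (Matrix.of ![v (Equiv.swap j₂ 3 0), v (Equiv.swap j₂ 3 1), v (Equiv.swap j₂ 3 2)]).det with hD₂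
  set P₁ := (∑ l, A (Equiv.swap j₁ 3 0) l * t₁ ^ d l) * (∑ l, A (Equiv.swap j₁ 3 1) l * t₁ ^ d l)
            * (∑ l, A (Equiv.swap j₁ 3 2) l * t₁ ^ d l) with hP₁
  set P₂ := (∑ l, A (Equiv.swap j₂ 3 0) l * t₂ ^ d l) * (∑ l, A (Equiv.swap j₂ 3 1) l * t₂ ^ d l)
            * (∑ l, A (Equiv.swap j₂ 3 2) l * t₂ ^ d l) with hP₂
  have hw1 : ((∑ l, (X : ℝ[X]) ^ d l • (∑ i, A i l • Matrix.vecMulVec (v i) (v i)).map C).det).eval t₁ = D₁ ^ 2 * P₁ := by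
    rw [hev]; exact det_eq_of_node_zero v (fun i => ∑ l, A i l * t₁ ^ d l) j₁ h₁
  have hw2 : ((∑ l, (X : ℝ[X]) ^ d l • (∑ i, A i l • Matrix.vecMulVec (v i) (v i)).map C).det).eval t₂ = D₂ ^ 2 * P₂ := by
    rw [hev]; exact det_eq_of_node_zero v (fun i => ∑ l, A i l * t₂ ^ d l) j₂ h₂
  have hne1 : ((∑ l, (X : ℝ[X]) ^ d l • (∑ i, A i l • Matrix.vecMulVec (v i) (v i)).map C).det).eval t₁ ≠ 0 := by
    rw [hev]; exact det_ne_zero_of_simpleWall' v _ hgp j₁ h₁ hne₁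
  have hne2 : ((∑ l, (X : ℝ[X]) ^ d l • (∑ i, A i l • Matrix.vecMulVec (v i) (v i)).map C).det).eval t₂ ≠ 0 := by
    rw [hev]; exact det_ne_zero_of_simpleWall' v _ hgp j₂ h₂ hne₂
  have hD1 : D₁ ≠ 0 := by
    intro h0; apply hne1; rw [hw1, h0]; ring
  have hD2 : D₂ ≠ 0 := by
    intro h0; apply hne2; rw [hw2, h0]; ring
  rw [even_countP_roots_Ioo_iff' _ hP ht hne1 hne2, hw1, hw2]
  have hpos : 0 < D₁ ^ 2 * D₂ ^ 2 := by positivity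
  have key : D₁ ^ 2 * P₁ * (D₂ ^ 2 * P₂) = (D₁ ^ 2 * D₂ ^ 2) * (P₁ * P₂) := by ring
  rw [key, mul_pos_iff_of_pos_left hpos]

end Summit.ValiantsHypothesis.ValiantsHypothesis.Theorems.LacunarySymmetroidMatrixDescartes.Census
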